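import Mathlib
import Summits.Ventures.FusionMHD.Models.CerfonFreidbergIterLikeQHalfMercDefs
import HarnessLib

/-!
# Ventures/FusionMHD — Models/CerfonFreidbergIterLikeQHalfMercPanels17.lean: KERNEL CHECK of the Mercier-register certificates of panel(s) 29 (of 32)
# at `ψ_N = 1/2` of THE Cerfon–Freidberg ITER-like instance

HONEST FRAMING (LADDER-GRIDFUSION three columns; CF rung; «F2.R2-CF-MERCIER-IMPLICIT» step (2), F2-SCOPING v1.6 §10(c)).  One `decide +kernel` (≈ 70 s): for each
listed panel the obligation `CFIterLike.QHalfMerc.MercCert.ok` (`Models/CerfonFreidbergIterLikeQHalfMercDefs.lean`) — the Taylor-model run of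
`progM = progA ++ block1 ++ block2 ++ block3M` over ★ #117's parameter box is ACCEPTED (both `inv` certificates included) and the kernel's FOUR panel-integral
enclosures (`g_W`, `g_Aσ`, `g_AR`, `g_B1` along the approximant) lie inside the claimed integers (read off a compiled `#eval` of the same functions, slack one unit of
`2⁻⁶⁰`; float truth inside every panel, `HOME/models/model-7/g7/genqm/truthM.json`).  MODELLED: analytic Cerfon–Freidberg family; nothing about a device or
stability.  No `native_decide`.  Typer/prover: gridfusion-model-7 (g7), 2026-08-27.
Citations: Jardin 2010 §8.5 (8.134) [Jardin2010]; Mahboubi–Melquiond–Sibut-Pinote 2016 §3.2 Lemma 3 [MahboubiMelquiondSibutpinote2016].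
-/

namespace Summit.Ventures.FusionMHD.Models.CFIterLike.QHalfMerc

/-- Mercier-register certificate data of panel(s) 29. [instance data] -/
def mercCert17 : List MercCert := [
  { j := 29, cand1 := [808803980806591217664, -1579000273804849053696, 11655181543848680620032, -20518749518506296868864, 76090462518139823325184, -69460346233848493768704, 6134524796326230622208, 1175683450772987995750400, -6008666594762863337799680, 27803208632627485760028672, 1463971945838785314204680192, -9621375309758409835429232640, -1938039127481739854782440407040],
    cand2 := [630029804026069778432, -757288795397705433088, 5598468336498108268544, -10245996920259378937856, 43135501895526365790208, -86470466620183216652288, 260753330855466158260224, -436750636805581705314304, 562434406373851979055104, 7494529857321790729093120, 677518485461196855150903296, -11492335641458125728122929152, -904479907832243691774590058496],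
    deg := 12, e1 := 43, e2 := 43, wlo := 577306744094419096, whi := 577306785005190867, slo := 9952904992970120138, shi := 9952905295485909237,
    rlo := 6444577914016183996, rhi := 6444578115633624019, blo := 15371131490865945396, bhi := 15371131944441730317 }]

/-- **KERNEL CHECK** of the four Mercier registers on panel(s) 29. -/
theorem mercCert17_ok : CFIterLike.QHalfMerc.mercCert17.all MercCert.ok = true := by
  decide +kernel

end Summit.Ventures.FusionMHD.Models.CFIterLike.QHalfMerc
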